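import Literature.NumberTheory.EllipticCurves.UniversalOrdinaryRing
import Literature.NumberTheory.EllipticCurves.DivisionPolynomialFormalMulProofs
import Literature.RingTheory.HenselLemma.Factorization
import Literature.RingTheory.AdicTopology.PrincipalCompletion
import HarnessLib

/-!
# The canonical factor `φ_ψ` of the `p`-division polynomial of the universal ordinary curve
# (Blakestad–Grant 2023, Prop. 7: `ψ_p = φ_ψ·ξ` over `R̂` by `p`-adic Weierstrass preparation;
# proofs only)

Trunk T-NT-EC (Literature/NumberTheory/EllipticCurves). Over Blakestad–Grant's ring
`R̂ = completeRing p` (`UniversalOrdinaryRing.lean`) the `p`-division polynomial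
`ψ_p = preΨ' p ∈ R̂[x]` of the universal ordinary curve `𝓔` (`p ≥ 5`, `p = 2n + 1`) has degree
`(p² - 1)/2` and leading coefficient `p`, while modulo `p` — the curve being ORDINARY, i.e. its
Hasse invariant `H = A_p` a unit of `R̂` — it has degree `(p² - p)/2` with unit leading coefficient
`±A_p` (weak Deuring: the tree's `natDegree_ΨSq_prime_eq`, `leadingCoeff_ΨSq_prime_eq` of
`DivisionPolynomialFormalMulProofs`, over the domain `R̂/p` of characteristic `p`). Hence the
`p`-adic Weierstrass preparation theorem for polynomials over the `p`-adically complete ring `R̂`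
(`Literature.RingTheory.HenselLemma.exists_monic_mul_eq_of_coeff_mem`) splits

  **`ψ_p = φ · ξ`,  `ξ ∈ R̂[x]` monic of degree `(p² - p)/2`,  `φ ∈ R̂[x]` of degree `n` with
  leading coefficient `p`, `φ ≡ φ(0) (mod p)` and `φ(0) ∈ R̂ˣ`** (`exists_canonicalFactor`).

This is Blakestad–Grant's `φ_ψ` (their proof of Prop. 7: "by the `p`-adic Weierstrass
preparation theorem … `ψ_p(x) = φ_ψ(x)·g(x)` with `φ_ψ` of degree `(p-1)/2` whose roots are the
`x`-coordinates of the points of the canonical subgroup … the constant term of `φ_ψ` is a unit and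
its other coefficients are divisible by `p`"); the identification of its roots with the canonical
subgroup is `CanonicalKernelProofs.exists_canonicalKernel` (roots of the monic `ξ` are integral,
roots of `φ ≡ unit (mod p)` are not).

## Sources

* C. Blakestad, D. Grant, J. Number Theory 249 (2023) (arXiv:1903.02480), Prop. 7 and its proof.
  [BlakestadGrant2023]
* N. Bourbaki, *Commutative Algebra*, Ch. III §4 no. 3 (Hensel; preparation). [Bourbaki1989CommAlg]
* J. H. Silverman, *AEC* 2nd ed. (2009), V.3.1(a), V.4.1(a), Exercise 3.7. [SilvermanAEC2009]

Pure proof file: no definitions, no named facts.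
-/

noncomputable section

open Polynomial

namespace Literature.NumberTheory.EllipticCurves.UniversalOrdinary

open Literature.RingTheory.AdicTopology Literature.RingTheory.HenselLemma

variable (p : ℕ) [Fact p.Prime]

/-- **The canonical factor of `ψ_p` over `R̂`** (Blakestad–Grant's `φ_ψ`): for `p ≥ 5`,
`p = 2n + 1`, there are `φ, ξ ∈ R̂[x]` with `ψ_p = φ·ξ`, `ξ` monic of degree `(p² - p)/2`,
`deg φ = n`, `lead φ = p`, `φ(0) ∈ R̂ˣ` and `φᵢ ∈ pR̂` for `i ≥ 1`.
[Blakestad–Grant 2023, Prop. 7 (proof: `p`-adic Weierstrass preparation of `ψ_p`)]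
[cite: BlakestadGrant2023, Prop. 7] -/
theorem exists_canonicalFactor (hp5 : 5 ≤ p) :
    ∃ (n : ℕ) (_ : 2 * n + 1 = p) (φ ξ : (completeRing p)[X]),
      (universalCurve p).preΨ' p = φ * ξ ∧ ξ.Monic ∧ ξ.natDegree = (p ^ 2 - p) / 2 ∧
      φ.natDegree = n ∧ φ.leadingCoeff = (p : completeRing p) ∧ IsUnit (φ.coeff 0) ∧
      ∀ i, 1 ≤ i → φ.coeff i ∈ Ideal.span {(p : completeRing p)} := by
  have hpp : p.Prime := Fact.out
  have hp2 : p ≠ 2 := by omega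
  have hodd : ¬ Even p := fun he => hp2 ((Nat.Prime.even_iff hpp).mp he)
  obtain ⟨n, hn⟩ : ∃ n, 2 * n + 1 = p := by
    rcases Nat.even_or_odd p with h | ⟨k, hk⟩
    · exact absurd h hodd
    · exact ⟨k, by omega⟩
  set R := completeRing p with hR
  set I : Ideal R := Ideal.span {(p : R)} with hI
  haveI : I.IsPrime := span_natCast_isPrime_completeRing p hp5
  haveI : IsDomain R := isDomain_completeRing p hp5
  set E := universalCurve p with hE
  set f : R[X] := E.preΨ' p with hf
  -- `p ≠ 0` in the domain `R̂`
  have hpR : (p : R) ≠ 0 := fun h0 => by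
    have h := (natCast_pow_mul_eq_zero_iff_completeRing p hp5 1 1).mp (by rw [pow_one, mul_one]; exact h0)
    exact one_ne_zero h
  -- degree `N = (p²-1)/2` and leading coefficient `p`
  set N := (p ^ 2 - 1) / 2 with hN
  set k := (p ^ 2 - p) / 2 with hk
  have hNn : N = 2 * n ^ 2 + 2 * n := by
    rw [hN, ← hn]; rw [show (2 * n + 1) ^ 2 - 1 = 2 * (2 * n ^ 2 + 2 * n) by
      rw [show (2 * n + 1) ^ 2 = 2 * (2 * n ^ 2 + 2 * n) + 1 by ring]; omega]; omega
  have hkn : k = 2 * n ^ 2 + n := by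
    rw [hk, ← hn]; rw [show (2 * n + 1) ^ 2 - (2 * n + 1) = 2 * (2 * n ^ 2 + n) by
      rw [show (2 * n + 1) ^ 2 = 2 * (2 * n ^ 2 + n) + (2 * n + 1) by ring]; omega]; omega
  have hNk : N = k + n := by omega
  have hfdeg : f.natDegree = N := by
    have h := E.natDegree_preΨ' (n := p) hpR
    rwa [if_neg hodd] at h
  have hfN : f.coeff N = (p : R) := by
    have h := E.coeff_preΨ' p
    rwa [if_neg hodd, if_neg hodd] at h
  -- reduction modulo `p`: degree `k` with unit leading coefficient (weak Deuring)
  set π := Ideal.Quotient.mk I with hπ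
  haveI : CharP (R ⧸ I) p := charP_quotient p hp5
  haveI : IsDomain (R ⧸ I) := Ideal.Quotient.isDomain I
  have hAunit : IsUnit ((E.map π).hasseCoeff p) := by
    rw [WeierstrassCurve.map_hasseCoeff]; exact (isUnit_hasseCoeff_universalCurve p).map π
  have hAbar : (E.map π).hasseCoeff p ≠ 0 := hAunit.ne_zero
  have hfbar : f.map π = (E.map π).preΨ' p := (WeierstrassCurve.map_preΨ' (W := E) π p).symm
  have hΨSq : (E.map π).ΨSq p = (f.map π) ^ 2 := by
    rw [WeierstrassCurve.ΨSq_ofNat, if_neg hodd, mul_one, hfbar]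
  have hbar0 : f.map π ≠ 0 := fun h0 => by
    have := (E.map π).ΨSq_prime_ne_zero_of_hasseCoeff_ne_zero p hp2 hAbar
    rw [hΨSq, h0, zero_pow two_ne_zero] at this; exact this rfl
  have hbardeg : (f.map π).natDegree = k := by
    have h := (E.map π).natDegree_ΨSq_prime_eq p hp2 hAbar
    rw [hΨSq, natDegree_pow] at h
    have : p ^ 2 - p = 2 * k := by
      rw [hk, ← hn, show (2 * n + 1) ^ 2 = 2 * (2 * n ^ 2 + n) + (2 * n + 1) by ring]; omega
    omega
  have hbarlc : IsUnit ((f.map π).leadingCoeff) := by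
    have h := (E.map π).leadingCoeff_ΨSq_prime_eq p hp2 hAbar
    rw [hΨSq, leadingCoeff_pow] at h
    rcases (sq_eq_sq_iff_eq_or_eq_neg).mp h with h1 | h1
    · rw [h1]; exact hAunit
    · rw [h1]; exact hAunit.neg
  -- the hypotheses of the preparation theorem
  have htop : ∀ i, k < i → f.coeff i ∈ I := fun i hi => by
    rw [← Ideal.Quotient.eq_zero_iff_mem, ← hπ, ← coeff_map]
    exact coeff_eq_zero_of_natDegree_lt (by rw [hbardeg]; exact hi)
  obtain ⟨c', hc'⟩ : ∃ c' : R, f.coeff k * c' - 1 ∈ I := by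
    obtain ⟨w, hw⟩ := hbarlc.exists_right_inv
    obtain ⟨c', rfl⟩ := Ideal.Quotient.mk_surjective w
    refine ⟨c', ?_⟩
    rw [← Ideal.Quotient.eq_zero_iff_mem, map_sub, map_one, map_mul, sub_eq_zero, ← hπ]
    rw [leadingCoeff, hbardeg, coeff_map] at hw
    exact hw
  obtain ⟨g, h, hgm, hgdeg, hhdeg, -, hhC, hfgh⟩ := exists_monic_mul_eq_of_coeff_mem I f k c' hc' htop
  -- read off `φ = h`, `ξ = g`
  have hh0 : h ≠ 0 := fun h0 => by
    rw [h0, mul_zero] at hfgh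
    have := congrArg natDegree hfgh
    rw [hfdeg, natDegree_zero] at this; omega
  have hhdeg' : h.natDegree = n := by
    have := congrArg natDegree hfgh
    rw [hgm.natDegree_mul' hh0, hfdeg, hgdeg] at this; omega
  have hhlc : h.leadingCoeff = (p : R) := by
    have := congrArg leadingCoeff hfgh
    rw [leadingCoeff_monic_mul hgm, leadingCoeff, hfdeg, hfN] at this
    exact this.symm
  have hhcoeff : ∀ i, (h - C (f.coeff k)).coeff i ∈ I := Ideal.mem_map_C_iff.mp hhC
  refine ⟨n, hn, h, g, by rw [hfgh, mul_comm], hgm, by rw [hgdeg], hhdeg', hhlc, ?_, fun i hi => ?_⟩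
  · refine isUnit_of_isUnit_mk I ?_
    have h0 := hhcoeff 0
    rw [coeff_sub, coeff_C_zero, ← Ideal.Quotient.eq_zero_iff_mem, map_sub, sub_eq_zero] at h0
    rw [h0]
    have : Ideal.Quotient.mk I (f.coeff k) = (f.map π).leadingCoeff := by
      rw [leadingCoeff, hbardeg, coeff_map]
    rw [this]; exact hbarlc
  · have := hhcoeff i
    rwa [coeff_sub, coeff_C, if_neg (by omega), sub_zero] at this

end Literature.NumberTheory.EllipticCurves.UniversalOrdinary
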